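import Summits.CriticalPhenomena.PercolationContinuityZ3.Theorems.Transplant.KNParaChainRun
import HarnessLib

/-!
# N1 (the `{±1}` node), LEVEL 1, (R) side: the ROOTED fixed-stride run — the wired root cell `U₀` behind the run origin, clearance of the regions
# `k ≥ 2` from `U₀`, the pieces and later cores ahead of the floor, and the CUT regions of strides `0, 1` (pure `ℤ` arithmetic over p1-g11's `ChainPara.RunPrm`)

builds on p205010 (kernel theorem, internal audit signed; external expert review pending) — nothing in this file uses p205010; nothing here is a claim
about the open node `SamePDropOfSkeletonNeg`.
Lane `prim-bschramm`, seat `prim-bschramm-p2` (gen 10; V112: the p2 lineage owns "regions + (R)" under N1; plan `HOME/prim-bschramm-p2-g10/N1-R-PLAN.md`;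
this is the N1 twin of the PLANAR part of `KNCells2ChainBandR`/`KNCells2RootRunBandRO` — the rooted regions); helper file (`--supports stmt-CriticalPhenomena-4575 --as helper`).

THE GEOMETRY OF THE ROOT UNDER P5-R1(a) (NEG-SCOPE v1.1: NO hop at the root; `U₀ :=` the root's `P_L`-cell, wired; the rooted run's first stride starts from
the cell's own exit face).  In run coordinates `(a, b)` relative to the run origin `t₀` (the first seed centre, INSIDE `U₀` at depth `d₀ ≥ 0` behind the exit
face, so that the seed box is wired and the first landing piece at `a = sLo ≥ n` is outside), the wired cell lies in the back half-plane `{a ≤ d₀}`.  D″ kept the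
rooted run clear of the wired cube by the length of the first hop (`RootBandOK.hlo`; `ρ₀` = the backward reach of the start rectangle); with no hop and link
boxes SYMMETRIC about the seed centre (`La ≥ sHi`), the regions of strides `0` and `1` MEET the back half-plane, and from stride `2` on they clear it under ONE
inequality on the run parameters (`two_le_clear`: `d₀ + q + 3·ea + La < 2·sLo`; for the x-run `xPrm n ℓ h R′ q N`: `d₀ + q + 3R′ < n`, i.e. the NEG-PARAMS floor
`n_L > d₀ + q + 3R′`).  What this file provides to the (R) residue (`SkelPhiRootRunN`, next), whichever event shape the design owner rules for strides `0, 1`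
(wired-floor advance over the cut region `region k ∩ {a > d₀}`, p5's option (c) shape; or a separate record):
* §1 `RunPrm.backLo k` (the lower along-bound of region `k`), `inRegion_backLo_le`, monotonicity `backLo_mono` (`ea ≤ sLo`), **`clear_of_lt_backLo`**, **`two_le_clear`**;
* §2 the landing pieces and the later cores lie AHEAD of the floor: **`landing_gt_floor`** (from the enlarged core `k`, every landing `a' ≥ a + sLo` has `a' > d₀` once
  `d₀ + q + (k+1)·ea < (k+1)·sLo`; at `k = 0`: `d₀ + q + ea < sLo`), `inCore_succ_gt_floor`;
* §3 the CUT region `InRegionCut d₀ k a b := InRegion k a b ∧ d₀ < a` (the step domain of strides `0, 1` under the wired-floor reading), `inRegionCut_of_clear` (for `k ≥ 2` the cut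
  is the whole region), `landing_mem_cut`, `link_box_front_mem_cut` (the forward half of the link box, `a' ≥ a`, lies in the cut region when the seed centre is ahead of the floor);
* §4 the x-run instance: `xPrm_backLo`, **`xPrm_two_le_clear (h : d₀ + q + 3R′ < n)`**, `xPrm_landing_gt_floor (h : d₀ + q + R′ < n)`.
[cite: KozmaNitzan2024, §4 p. 27 (G₀: the wired root box), Lemma 11 (pp. 22–23)] [cite: MartineauTassion2017, §4.1 (the cells B_z), §4.3 Lemma 4.2]
-/

namespace Summit.CriticalPhenomena.PercolationContinuityZ3.Theorems.Transplant

namespace ChainPara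

namespace RunPrm

variable (P : RunPrm)

/-! ## §1 The backward reach of the regions and the clearance of the wired cell -/

/-- **The lower along-bound of region `k`**: `aLo k − ea − La = k·sLo − q − (k+1)·ea − La`. [this work] -/
def backLo (k : ℕ) : ℤ := P.aLo k - P.ea - P.La

/-- `backLo` unfolded. [folklore] -/
theorem backLo_eq (k : ℕ) : P.backLo k = (k : ℤ) * P.sLo - P.q - ((k : ℤ) + 1) * P.ea - P.La := by
  simp only [backLo, aLo]; ring

variable {P}

/-- A point of region `k` lies at or above `backLo k` along. [folklore] -/
theorem backLo_le_of_inRegion {k : ℕ} {a b : ℤ} (h : P.InRegion k a b) : P.backLo k ≤ a := by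
  obtain ⟨h1, -, -, -⟩ := h
  simpa [backLo] using h1

/-- **Clearance**: if the floor `d₀` lies strictly below `backLo k`, region `k` misses the back half-plane `{a ≤ d₀}`. [this work] -/
theorem clear_of_lt_backLo {k : ℕ} {d₀ : ℤ} (hd : d₀ < P.backLo k) {a b : ℤ} (h : P.InRegion k a b) : d₀ < a :=
  lt_of_lt_of_le hd (backLo_le_of_inRegion h)

/-- `backLo` is monotone in `k` as soon as one stride's progress covers its along slack (`ea ≤ sLo`). [folklore] -/
theorem backLo_mono (hP : (P.ea : ℤ) ≤ P.sLo) {k k' : ℕ} (hk : k ≤ k') : P.backLo k ≤ P.backLo k' := by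
  rw [backLo_eq, backLo_eq]
  have hk' : (k : ℤ) ≤ k' := by exact_mod_cast hk
  nlinarith

/-- **From stride `2` on the regions clear the wired cell**: `d₀ + q + 3·ea + La < 2·sLo` and `ea ≤ sLo` give `d₀ < a` on every region `k ≥ 2`.
[cite: KozmaNitzan2024, §4 Lemma 11 (p. 22: the slabs of Ω are disjoint from G₀'s box)] -/
theorem two_le_clear (hP : (P.ea : ℤ) ≤ P.sLo) {d₀ : ℤ} (hd : d₀ + P.q + 3 * P.ea + P.La < 2 * P.sLo) {k : ℕ} (hk : 2 ≤ k) {a b : ℤ}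
    (h : P.InRegion k a b) : d₀ < a := by
  refine clear_of_lt_backLo (lt_of_lt_of_le ?_ (backLo_mono hP hk)) h
  rw [backLo_eq]; push_cast; linarith

/-! ## §2 Landings and later cores lie ahead of the floor -/

/-- **Every landing of stride `k` lies ahead of the floor** when `d₀ + q + (k+1)·ea < (k+1)·sLo`: from a seed centre `(a, b)` of the enlarged core `k`, every
`a' ≥ a + sLo` has `d₀ < a'`. [cite: MartineauTassion2017, §4.3 Lemma 4.2] -/
theorem landing_gt_floor {k : ℕ} {d₀ : ℤ} (hd : d₀ + P.q + ((k : ℤ) + 1) * P.ea < ((k : ℤ) + 1) * P.sLo) {a b : ℤ} (hv : P.InEnl k a b)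
    {a' : ℤ} (ha : P.sLo ≤ a' - a) : d₀ < a' := by
  obtain ⟨h1, -, -, -⟩ := hv
  simp only [aLo] at h1
  linarith

/-- **Core `k + 1` lies ahead of the floor** when `d₀ + q + (k+1)·ea < (k+1)·sLo`. [folklore] -/
theorem inCore_succ_gt_floor {k : ℕ} {d₀ : ℤ} (hd : d₀ + P.q + ((k : ℤ) + 1) * P.ea < ((k : ℤ) + 1) * P.sLo) {a b : ℤ}
    (h : P.InCore (k + 1) a b) : d₀ < a := by
  obtain ⟨h1, -, -, -⟩ := h
  simp only [aLo, Nat.cast_add, Nat.cast_one] at h1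
  linarith

/-! ## §3 The cut regions of the first strides -/

/-- **The CUT region of stride `k`**: the part of region `k` strictly ahead of the floor `d₀` (the step domain of strides `0, 1` under the wired-floor reading:
edges behind the floor belong to the wired root cell). [cite: KozmaNitzan2024, §4 p. 27 (G₀) and Lemma 11 (p. 22)] -/
def InRegionCut (d₀ : ℤ) (k : ℕ) (a b : ℤ) : Prop := P.InRegion k a b ∧ d₀ < a

/-- The cut region lies in the region. [folklore] -/
theorem inRegion_of_inRegionCut {d₀ : ℤ} {k : ℕ} {a b : ℤ} (h : P.InRegionCut d₀ k a b) : P.InRegion k a b := h.1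

/-- **For a cleared stride the cut is the whole region** (e.g. `k ≥ 2` under `two_le_clear`). [folklore] -/
theorem inRegionCut_of_clear {d₀ : ℤ} {k : ℕ} (hclear : ∀ a b, P.InRegion k a b → d₀ < a) {a b : ℤ} (h : P.InRegion k a b) :
    P.InRegionCut d₀ k a b := ⟨h, hclear a b h⟩

/-- **The forward part of the link box lies in the cut region**: from a seed centre `(a, b)` of the enlarged core `k` with `d₀ < a`, every point of the link box
that is not behind the seed centre (`a ≤ a'`) lies in the cut region. [this work] -/
theorem link_front_mem_cut {k : ℕ} {d₀ a b : ℤ} (hv : P.InEnl k a b) (ha0 : d₀ < a) {a' b' : ℤ} (hfw : a ≤ a') (ha : |a' - a| ≤ P.La)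
    (hb : |b' - b| ≤ P.Lb) : P.InRegionCut d₀ k a' b' :=
  ⟨inRegion_of_link hv ha hb, lt_of_lt_of_le ha0 hfw⟩

/-- **The landing of a stride from a seed ahead of the reduced floor lies in the cut region and in the next core** (route property, cut form).
[cite: MartineauTassion2017, §4.3 Lemma 4.2] -/
theorem landing_mem_cut (hP : RunOK P) {k : ℕ} {d₀ : ℤ} (hd : d₀ + P.q + ((k : ℤ) + 1) * P.ea < ((k : ℤ) + 1) * P.sLo) {a b : ℤ}
    (hv : P.InEnl k a b) {a' b' : ℤ} (ha1 : P.sLo ≤ a' - a) (ha2 : a' - a ≤ P.sHi) (hb : P.InPiece (P.steer k b) (b' - b - P.d)) :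
    P.InRegionCut d₀ k a' b' ∧ P.InCore (k + 1) a' b' := by
  have hcore := inCore_succ_of_landing hP hv ha1 ha2 hb
  exact ⟨⟨inRegion_of_inCore_succ hP hcore, landing_gt_floor hd hv ha1⟩, hcore⟩

end RunPrm

/-! ## §4 The x-run at the root -/

/-- `backLo` of the x-run: `k·n − q − (k+1)·R′ − n`. [folklore] -/
theorem xPrm_backLo (n ℓ : ℕ) (h : ℤ) (R' q N : ℕ) (k : ℕ) :
    (xPrm n ℓ h R' q N).backLo k = (k : ℤ) * n - q - ((k : ℤ) + 1) * R' - n := by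
  rw [RunPrm.backLo_eq]; simp [xPrm]

/-- **Root x-run: from stride `2` on the regions clear the wired cell**, under the floor inequality `d₀ + q + 3R′ < n` (and `R′ ≤ n`).
[cite: KozmaNitzan2024, §4 p. 27 (G₀), Lemma 11 (p. 22)] -/
theorem xPrm_two_le_clear {n ℓ : ℕ} {h : ℤ} {R' q N : ℕ} {d₀ : ℤ} (hR : R' ≤ n) (hd : d₀ + q + 3 * R' < n) {k : ℕ} (hk : 2 ≤ k)
    {a b : ℤ} (hab : (xPrm n ℓ h R' q N).InRegion k a b) : d₀ < a := by
  refine RunPrm.two_le_clear (P := xPrm n ℓ h R' q N) (by simp [xPrm]; exact_mod_cast hR) ?_ hk hab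
  simp only [xPrm]; linarith

/-- **Root x-run: every landing of the first stride lies ahead of the floor**, under `d₀ + q + R′ < n`. [cite: MartineauTassion2017, §4.3 Lemma 4.2] -/
theorem xPrm_landing_zero_gt_floor {n ℓ : ℕ} {h : ℤ} {R' q N : ℕ} {d₀ : ℤ} (hd : d₀ + q + R' < n) {a b : ℤ}
    (hv : (xPrm n ℓ h R' q N).InEnl 0 a b) {a' : ℤ} (ha : (n : ℤ) ≤ a' - a) : d₀ < a' := by
  refine RunPrm.landing_gt_floor (P := xPrm n ℓ h R' q N) (k := 0) ?_ hv (by simpa [xPrm] using ha)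
  simp only [xPrm]; push_cast; linarith

end ChainPara

end Summit.CriticalPhenomena.PercolationContinuityZ3.Theorems.Transplant
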